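import Mathlib.Algebra.BigOperators.Ring.Finset
import Mathlib.Algebra.BigOperators.Pi
import Mathlib.Data.Fintype.BigOperators
import Mathlib.Data.Nat.Choose.Sum
import Mathlib.Algebra.Field.Basic
import Mathlib.Tactic.Ring
import Mathlib.Tactic.FieldSimp
import HarnessLib

/-!
# Waldschmidt 1980, §3.4: the binomial re-centring in the passage from step `J` to step `J + 1`

Support file (theorems only, no definitions, no named facts) for the archimedean input of the
Stewart–Yu 1991 line of `Literature.Barriers.ABC.stewartYu1991_upperBound` (M. Waldschmidt,
*A lower bound for linear forms in logarithms*, Acta Arith. **37** (1980), Prop. 3.8 over `ℚ`,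
`q = 2`; see `Waldschmidt1980Endgame.lean` for the context).

At the end of the main inductive argument (p. 273) the coefficients are re-indexed by
`λⱼ = λⱼ⁰ + q λⱼ'` (`0 ≤ λⱼ⁰ < q`), and the factors `(λᵣ + λₙβᵣ)^{τᵣ}` of the auxiliary function
have to be re-centred: "We use first Lemma 2.5 to see that the same holds with
`(λₙ⁰/q + λₙ)^{τ₀}` replaced by `λₙ^{τ₀}`, and then the relations
`λᵣ + λₙβᵣ = (1/q)(λᵣ⁰ + λᵣq + (λₙ⁰ + λₙq)βᵣ − (λᵣ⁰ + λₙ⁰βᵣ))` to see that the same holds with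
`λ₁⁰ + λ₁q, …, λₙ⁰ + λₙq` replaced by `λ₁, …, λₙ`." Both steps are instances of one principle:
the vanishing of `∑_λ P(λ) ∏ᵣ γᵣ(λ)^{τᵣ}` for all `τ` in a DOWNWARD-CLOSED set of multi-indices
is unchanged when every `γᵣ` is replaced by `aᵣ γᵣ + cᵣ` with `aᵣ ≠ 0` and `cᵣ` independent of `λ`
(expand by the binomial theorem: only smaller multi-indices occur). This file proves exactly that:

* `sum_mul_prod_add_pow_eq_zero` — one direction for the shift `γ ↦ γ + c`;
* `sum_mul_prod_add_pow_eq_zero_iff` — the equivalence (apply the first with `c` and `−c`);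
* `sum_mul_prod_mul_add_pow_eq_zero_iff` — the affine version `γ ↦ a γ + c`, `aᵣ ≠ 0`, over a
  field (Waldschmidt's `q (λᵣ + λₙβᵣ) + (λᵣ⁰ + λₙ⁰βᵣ)`).

Waldschmidt's Lemma 2.5 itself (= Cijsouw–Waldschmidt 1977, Lemma 5: the same principle for the
factor `(λₙβ₀)^{τ₀'}` coming from `e^{λₙβ₀z}`) is not needed on the Stewart–Yu line, where the
linear form is homogeneous (`β₀ = 0`, so `A_J(z, τ)` has only its `τ₀' = 0` term); it is not
vendored here.

## References

* [Waldschmidt1980] M. Waldschmidt, *A lower bound for linear forms in logarithms*, Acta Arith. 37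
  (1980), 257–283 — Lemma 2.5 (p. 262) and the end of §3.4 (p. 273).
* [CijsouwWaldschmidt1977] P. L. Cijsouw, M. Waldschmidt, *Linear forms and simultaneous
  approximations*, Compositio Math. 34 (1977), 173–197 — Lemma 5 (pp. 181–182).
-/

open Finset

namespace Literature.NumberTheory.Transcendental.Waldschmidt1980

section CommRing

variable {R : Type*} [CommRing R] {ι Λ : Type*} [Fintype ι] [DecidableEq ι] [Fintype Λ]

/-- **The multinomial expansion of a shifted monomial**:
`∏ᵣ (γᵣ + cᵣ)^{τᵣ} = ∑_{k ≤ τ} (∏ᵣ binom(τᵣ, kᵣ) cᵣ^{τᵣ − kᵣ}) ∏ᵣ γᵣ^{kᵣ}`, the sum over the box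
`0 ≤ kᵣ ≤ τᵣ`. [folklore] -/
theorem prod_add_pow_eq_sum_piFinset (γ c : ι → R) (τ : ι → ℕ) :
    ∏ r, (γ r + c r) ^ τ r =
      ∑ k ∈ Fintype.piFinset fun r => range (τ r + 1),
        (∏ r, (((τ r).choose (k r) : ℕ) : R) * c r ^ (τ r - k r)) * ∏ r, γ r ^ k r := by
  have h1 : ∀ r, (γ r + c r) ^ τ r =
      ∑ j ∈ range (τ r + 1), (((τ r).choose j : ℕ) : R) * c r ^ (τ r - j) * γ r ^ j := by
    intro r
    rw [add_pow]
    refine Finset.sum_congr rfl fun j _ => ?_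
    ring
  simp_rw [h1]
  rw [Finset.prod_univ_sum]
  refine Finset.sum_congr rfl fun k _ => ?_
  rw [← Finset.prod_mul_distrib]

/-- **Binomial re-centring, one direction** (the principle behind Waldschmidt 1980, Lemma 2.5 and
the end of §3.4): let `D` be a downward-closed set of multi-indices. If
`∑_λ P(λ) ∏ᵣ γᵣ(λ)^{μᵣ} = 0` for all `μ ∈ D`, then `∑_λ P(λ) ∏ᵣ (γᵣ(λ) + cᵣ)^{τᵣ} = 0` for all
`τ ∈ D`, for any constants `cᵣ`. [cite: Waldschmidt1980, Lemma 2.5 and §3.4 (p. 273)] -/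
theorem sum_mul_prod_add_pow_eq_zero (D : (ι → ℕ) → Prop)
    (hD : ∀ τ μ : ι → ℕ, μ ≤ τ → D τ → D μ) (P : Λ → R) (γ : Λ → ι → R) (c : ι → R)
    (h : ∀ μ, D μ → ∑ l, P l * ∏ r, γ l r ^ μ r = 0) :
    ∀ τ, D τ → ∑ l, P l * ∏ r, (γ l r + c r) ^ τ r = 0 := by
  intro τ hτ
  calc ∑ l, P l * ∏ r, (γ l r + c r) ^ τ r
      = ∑ l, ∑ k ∈ Fintype.piFinset fun r => range (τ r + 1),
          P l * ((∏ r, (((τ r).choose (k r) : ℕ) : R) * c r ^ (τ r - k r)) *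
            ∏ r, γ l r ^ k r) := by
        refine Finset.sum_congr rfl fun l _ => ?_
        rw [prod_add_pow_eq_sum_piFinset, Finset.mul_sum]
    _ = ∑ k ∈ Fintype.piFinset fun r => range (τ r + 1),
          (∏ r, (((τ r).choose (k r) : ℕ) : R) * c r ^ (τ r - k r)) *
            ∑ l, P l * ∏ r, γ l r ^ k r := by
        rw [Finset.sum_comm]
        refine Finset.sum_congr rfl fun k _ => ?_
        rw [Finset.mul_sum]
        refine Finset.sum_congr rfl fun l _ => ?_
        ring
    _ = 0 := by
        refine Finset.sum_eq_zero fun k hk => ?_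
        have hkτ : k ≤ τ := fun r =>
          Nat.lt_succ_iff.mp (mem_range.mp (Fintype.mem_piFinset.mp hk r))
        rw [h k (hD τ k hkτ hτ), mul_zero]

/-- **Binomial re-centring** (Waldschmidt 1980, Lemma 2.5 / p. 273): for a downward-closed set `D`
of multi-indices and constants `cᵣ`,
`(∀ τ ∈ D, ∑_λ P(λ) ∏ᵣ (γᵣ(λ) + cᵣ)^{τᵣ} = 0) ↔ (∀ τ ∈ D, ∑_λ P(λ) ∏ᵣ γᵣ(λ)^{τᵣ} = 0)`.
[cite: Waldschmidt1980, Lemma 2.5 and §3.4 (p. 273)] -/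
theorem sum_mul_prod_add_pow_eq_zero_iff (D : (ι → ℕ) → Prop)
    (hD : ∀ τ μ : ι → ℕ, μ ≤ τ → D τ → D μ) (P : Λ → R) (γ : Λ → ι → R) (c : ι → R) :
    (∀ τ, D τ → ∑ l, P l * ∏ r, (γ l r + c r) ^ τ r = 0) ↔
      (∀ τ, D τ → ∑ l, P l * ∏ r, γ l r ^ τ r = 0) := by
  constructor
  · intro h
    have h' := sum_mul_prod_add_pow_eq_zero D hD P (fun l r => γ l r + c r) (fun r => -c r) h
    simpa using h'
  · exact sum_mul_prod_add_pow_eq_zero D hD P γ c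

end CommRing

section Field

variable {K : Type*} [Field K] {ι Λ : Type*} [Fintype ι] [DecidableEq ι] [Fintype Λ]

/-- **Affine re-centring** (the form used on p. 273 of Waldschmidt 1980, where
`q(λᵣ + λₙβᵣ) + (λᵣ⁰ + λₙ⁰βᵣ)` replaces `λᵣ + λₙβᵣ`): for a downward-closed set `D` of
multi-indices, non-zero scalars `aᵣ` and constants `cᵣ`,
`(∀ τ ∈ D, ∑_λ P(λ) ∏ᵣ (aᵣ γᵣ(λ) + cᵣ)^{τᵣ} = 0) ↔ (∀ τ ∈ D, ∑_λ P(λ) ∏ᵣ γᵣ(λ)^{τᵣ} = 0)`.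
[cite: Waldschmidt1980, §3.4 (p. 273)] -/
theorem sum_mul_prod_mul_add_pow_eq_zero_iff (D : (ι → ℕ) → Prop)
    (hD : ∀ τ μ : ι → ℕ, μ ≤ τ → D τ → D μ) (P : Λ → K) (γ : Λ → ι → K) (a c : ι → K)
    (ha : ∀ r, a r ≠ 0) :
    (∀ τ, D τ → ∑ l, P l * ∏ r, (a r * γ l r + c r) ^ τ r = 0) ↔
      (∀ τ, D τ → ∑ l, P l * ∏ r, γ l r ^ τ r = 0) := by
  -- `a γ + c = a (γ + c/a)` and `∏ (a(γ + c/a))^τ = (∏ a^τ) ∏ (γ + c/a)^τ`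
  have hfac : ∀ (l : Λ) (τ : ι → ℕ), ∏ r, (a r * γ l r + c r) ^ τ r =
      (∏ r, a r ^ τ r) * ∏ r, (γ l r + c r / a r) ^ τ r := by
    intro l τ
    rw [← Finset.prod_mul_distrib]
    refine Finset.prod_congr rfl fun r _ => ?_
    rw [← mul_pow]
    congr 1
    field_simp [ha r]
  have hstep : (∀ τ, D τ → ∑ l, P l * ∏ r, (a r * γ l r + c r) ^ τ r = 0) ↔
      (∀ τ, D τ → ∑ l, P l * ∏ r, (γ l r + c r / a r) ^ τ r = 0) := by
    have hne : ∀ τ : ι → ℕ, (∏ r, a r ^ τ r) ≠ 0 := fun τ =>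
      Finset.prod_ne_zero_iff.mpr fun r _ => pow_ne_zero _ (ha r)
    have hrew : ∀ τ : ι → ℕ, ∑ l, P l * ∏ r, (a r * γ l r + c r) ^ τ r =
        (∏ r, a r ^ τ r) * ∑ l, P l * ∏ r, (γ l r + c r / a r) ^ τ r := by
      intro τ
      rw [Finset.mul_sum]
      refine Finset.sum_congr rfl fun l _ => ?_
      rw [hfac]; ring
    constructor
    · intro h τ hτ
      have h1 := h τ hτ
      rw [hrew τ] at h1
      exact (mul_eq_zero.mp h1).resolve_left (hne τ)
    · intro h τ hτ
      rw [hrew τ, h τ hτ, mul_zero]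
  rw [hstep]
  exact sum_mul_prod_add_pow_eq_zero_iff D hD P γ fun r => c r / a r

end Field

end Literature.NumberTheory.Transcendental.Waldschmidt1980
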